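import Summits.BirchSwinnertonDyer.Rank1Residual.Additive.ChiBranchLowerTransport
import Summits.BirchSwinnertonDyer.Rank1Residual.AdditivePotMult.PStarTwistModel
import Summits.BirchSwinnertonDyer.Rank1Residual.Additive.CycLeadingTermDvd
import HarnessLib

/-!
# The LOWER half at an additive prime, (M) locus: the `χ_p`-branch form and the cyclotomic form at
# `T = 0` are EQUIVALENT on X4(M) / X3♯(M) (cell `b2b-bsdres`, team n1011, seat p07, row T-N10-low;
# sequel of `ChiBranchLowerTransport.lean`)

HONEST FRAMING (cell `b2b-bsdres`, run/shared/lean/b2b/bsd-rank1-residual/, verbatim in every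
file): the goal of the cell is to DELETE the COMBINATION-SHAPED residual classes of the
Birch–Swinnerton-Dyer formula for ALL analytic-rank `≤ 1` elliptic curves over `ℚ` — "full BSD
formula for every rank `≤ 1` curve in class `C`" assembled STRICTLY from published theorems — so
that the rank-`≤ 1` remainder becomes exactly the CONSTRUCTION-SHAPED classes, which are TYPED
(missing-input `Prop`s), NOT attempted. This is not "finishing BSD". Team n1011 (RESIDUAL-MAP §I
N10 / N11): prove what is provable now; shrink each hard class to its core with data; no claim
beyond stated classes. Research route on the CONSTRUCTION-SHAPED item N10; N10 stays CONSTRUCTION;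
nothing is booked; no label moves. Theorems only (no definition, no new named fact).

On X4(M) (`ClassX4M`: additive, `E[p]` irreducible, `ord_p j < 0`) and X3♯(M) (`ClassX3M`) the
semistable-twist datum of `ChiBranchLowerTransport.lean` §1–§2 is SUPPLIED by additive-p1's minimal
multiplicative twist model `E♭` (`ClassX4M/ClassX3M.exists_mult_pStar_twist_model`) with its newform
and period ratios from a parametrisation datum (`hmodD`), so the team's typed LOWER input at `T = 0`
(`CycLowerLeadingTermAt W p`, additive-p2 — Delbourgo's Main Conjecture (M), Skinner–Urban direction,
at the trivial character) is EQUIVALENT to its `χ_p`-branch form (`ChiBranchLowerLeadingTerm[Odd]At W p`,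
this seat — the Skinner–Urban direction on the `ω^{(p−1)/2}`-component of the `p`-MULTIPLICATIVE curve
`E♭`): `ClassX4M.cycLowerLeadingTermAt_iff_chiBranchLower` (`p ≡ 1 (mod 4)`, binder `hPal`),
`ClassX4M.cycLowerLeadingTermAt_iff_chiBranchLowerOdd` (`p ≡ 3 (mod 4)`, `p = 3` included; Pal proved),
and the X3♯(M) twins; the END-TO-END Miller forms
`ClassX4M/ClassX3M.missingLowerBoundAt_rankZero_of_chiBranchLower[Odd]` (branch input ⟹
`Typed.MissingLowerBoundAt W p`, through `cycLeadingTermDvdAt_of_cycLowerLeadingTermAt` — the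
generator form implies n1011-p18's every-element form `CycLeadingTermDvdAt`, `char_Λ X` being principal —
and p18's consumer over the exact Delbourgo 1998 Prop. 4 (M), `hDelX`); and the NON-VACUITY witnesses
`ClassX4M.exists_semistableTwistDatum[_odd]` (the binder set of the ∀-typed inputs is inhabited on
every X4(M) pair: twist model, newform, period ratio, cyclotomic datum and dual datum all exist).
Neither form is in print for any pair (RESIDUAL-MAP §I N10; at a MULTIPLICATIVE
`p` even the announcement of Burungale–Skinner–Tian–Wan, arXiv:2409.01350, does not apply:
`p ∤ 6N_g` there). Labels UNCHANGED.

References: Pal 2012 [Pal2012] Thm. 3.2; Mazur–Tate–Teitelbaum 1986 [MazurTateTeitelbaum1986Invent]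
§I.8; Silverman *ATAEC* V.5.3 [SilvermanATAEC1994]; Edixhoven 1991 [EdixhovenManin1991] §1.
-/

noncomputable section

open scoped Classical MatrixGroups ModularForm NumberField

open CongruenceSubgroup WeierstrassCurve NumberField Literature.NumberTheory.EllipticCurves
  Literature.NumberTheory.EllipticCurves.ModularForms
  Literature.NumberTheory.EllipticCurves.Rank1Residual
  Literature.NumberTheory.EllipticCurves.Rank1Residual.Typed
  IsDedekindDomain Rat.HeightOneSpectrum

namespace Summit.BirchSwinnertonDyer.Rank1Residual.Additive

variable (W : WeierstrassCurve ℚ) (p : ℕ) [hp : Fact p.Prime]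

omit hp in
/-- **Generator form ⟹ every-element form**: additive-p2's `CycLowerLeadingTermAt W p` (every
GENERATOR `f` of `char_Λ X(E/ℚ_∞)` has `f(0) ∈ (L(E,1)/Ω_E)·ℤ_p`) implies n1011-p18's
`CycLeadingTermDvdAt W p` (every ELEMENT `g` does): `char_Λ X` is principal
(`charIdeal_isPrincipal_holds`), `g = k · f`, `g(0) = k(0) · f(0)`. Bookkeeping between the two
spellings of the team's one typed `T = 0` lower input (lead ruling 05:04Z).
[cite: Delbourgo1998, Main Conjecture (p. 151) (shape only; nothing asserted)] -/
theorem cycLeadingTermDvdAt_of_cycLowerLeadingTermAt [Fact p.Prime] (h : CycLowerLeadingTermAt W p) :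
    CycLeadingTermDvdAt W p := by
  intro κ γ hκ hγ hγ' D g hgmem
  haveI : (Module.charIdeal (IwasawaAlgebra p) D.X).IsPrincipal := charIdeal_isPrincipal_holds p D.X
  obtain ⟨f₀, hf₀⟩ := Submodule.IsPrincipal.principal (Module.charIdeal (IwasawaAlgebra p) D.X)
  obtain ⟨q, hLq, c, hc⟩ := h κ γ hκ hγ hγ' D f₀ hf₀
  have hgspan : g ∈ Ideal.span {f₀} := by
    change g ∈ Module.charIdeal (IwasawaAlgebra p) D.X at hgmem
    rwa [hf₀] at hgmem
  obtain ⟨k, hk⟩ := Ideal.mem_span_singleton'.mp hgspan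
  refine ⟨PowerSeries.constantCoeff k * c, q, hLq, ?_⟩
  rw [← hk, map_mul, PadicInt.coe_mul, PadicInt.coe_mul, hc, mul_assoc]

end Summit.BirchSwinnertonDyer.Rank1Residual.Additive

namespace Summit.BirchSwinnertonDyer.Rank1Residual.AdditivePotMult

open Additive

variable {W : WeierstrassCurve ℚ} [W.IsElliptic] [W.IsGloballyMinimal] {p : ℕ} [hp : Fact p.Prime]

/-- **X4(M), `p ≡ 1 (mod 4)`: the two LOWER currencies are EQUIVALENT** —
`CycLowerLeadingTermAt W p ↔ ChiBranchLowerLeadingTermAt W p` — the datum being the multiplicative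
minimal twist model `E♭` (`ClassX4M.exists_mult_pStar_twist_model`, additive-p1) with its newform and
period ratio (`hmodD`). So on X4(M) the team's missing LOWER input at `T = 0` may be delivered
either as Delbourgo's Main Conjecture (M) (lower direction) or as the Skinner–Urban direction on the
`ω^{(p−1)/2}`-component of the `p`-multiplicative curve `E♭`. [cite: Pal2012, Thm. 3.2]
[cite: EdixhovenManin1991, §1] [cite: SilvermanATAEC1994, V.5.3] -/
theorem ClassX4M.cycLowerLeadingTermAt_iff_chiBranchLower
    (hPal : Pal2012.thm32_sqrt_mul_realPeriodRat_twist_eq_of_prime_one_mod_four)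
    (hmod : hasEntireLFunction_rat) (hmodD : nonempty_modularParametrizationData)
    (hX : ClassX4M W p) (hp4 : p % 4 = 1) :
    CycLowerLeadingTermAt W p ↔ ChiBranchLowerLeadingTermAt W p := by
  refine ⟨chiBranchLowerLeadingTermAt_of_cycLower W p hPal hmod hX.classX4.2.1, fun hLow ↦ ?_⟩
  obtain ⟨V, iV, iVm, C, hV, hC⟩ := hX.exists_mult_pStar_twist_model
  rw [pStar_eq_self_of_mod_four_eq_one hp4] at hC
  haveI : NeZero (V.conductorNorm ℤ) := ⟨(V.conductorNorm_pos_holds).ne'⟩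
  obtain ⟨Dm⟩ := hmodD V
  obtain ⟨ϖ, -, hϖ, -⟩ := Dm.exists_rat_mul_realPeriodRat_eq_plusPeriod
  exact cycLowerLeadingTermAt_of_chiBranchLower W p hPal hmod hp4 hX.classX4.2.1 V ⟨C, hC⟩
    (Or.inr hV) Dm.isNewformOf ϖ hϖ hLow

/-- **X4(M), `p ≡ 3 (mod 4)` (`p = 3` included): the two LOWER currencies are EQUIVALENT** —
`CycLowerLeadingTermAt W p ↔ ChiBranchLowerLeadingTermOddAt W p`. [cite: Pal2012, Thm. 3.2]
[cite: EdixhovenManin1991, §1] [cite: SilvermanATAEC1994, V.5.3] -/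
theorem ClassX4M.cycLowerLeadingTermAt_iff_chiBranchLowerOdd
    (hmod : hasEntireLFunction_rat) (hmodD : nonempty_modularParametrizationData)
    (hX : ClassX4M W p) (hp4 : p % 4 = 3) :
    CycLowerLeadingTermAt W p ↔ ChiBranchLowerLeadingTermOddAt W p := by
  refine ⟨chiBranchLowerLeadingTermOddAt_of_cycLower W p hmod hX.classX4.2.1, fun hLow ↦ ?_⟩
  obtain ⟨V, iV, iVm, C, hV, hC⟩ := hX.exists_mult_pStar_twist_model
  rw [pStar_eq_neg_of_mod_four_eq_three hp4] at hC
  haveI : NeZero (V.conductorNorm ℤ) := ⟨(V.conductorNorm_pos_holds).ne'⟩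
  obtain ⟨Dm⟩ := hmodD V
  obtain ⟨ϖ, -, hϖ⟩ := exists_rat_mul_imaginaryPeriodRat_eq_minusPeriod Dm
  exact cycLowerLeadingTermAt_of_chiBranchLowerOdd W p hmod hp4 hX.classX4.2.1 V C hC (Or.inr hV)
    Dm.isNewformOf ϖ hϖ hLow

/-- **X3♯(M), `p ≡ 1 (mod 4)`: the two LOWER currencies are EQUIVALENT** (datum
`ClassX3M.exists_mult_pStar_twist_model`). [cite: Pal2012, Thm. 3.2] [cite: EdixhovenManin1991, §1]
[cite: SilvermanATAEC1994, V.5.3] -/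
theorem ClassX3M.cycLowerLeadingTermAt_iff_chiBranchLower
    (hPal : Pal2012.thm32_sqrt_mul_realPeriodRat_twist_eq_of_prime_one_mod_four)
    (hmod : hasEntireLFunction_rat) (hmodD : nonempty_modularParametrizationData)
    (hX : ClassX3M W p) (hp4 : p % 4 = 1) :
    CycLowerLeadingTermAt W p ↔ ChiBranchLowerLeadingTermAt W p := by
  refine ⟨chiBranchLowerLeadingTermAt_of_cycLower W p hPal hmod hX.classX3.2, fun hLow ↦ ?_⟩
  obtain ⟨V, iV, iVm, C, hV, hC⟩ := hX.exists_mult_pStar_twist_model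
  rw [pStar_eq_self_of_mod_four_eq_one hp4] at hC
  haveI : NeZero (V.conductorNorm ℤ) := ⟨(V.conductorNorm_pos_holds).ne'⟩
  obtain ⟨Dm⟩ := hmodD V
  obtain ⟨ϖ, -, hϖ, -⟩ := Dm.exists_rat_mul_realPeriodRat_eq_plusPeriod
  exact cycLowerLeadingTermAt_of_chiBranchLower W p hPal hmod hp4 hX.classX3.2 V ⟨C, hC⟩
    (Or.inr hV) Dm.isNewformOf ϖ hϖ hLow

/-- **X3♯(M), `p ≡ 3 (mod 4)` (`p = 3` included): the two LOWER currencies are EQUIVALENT.**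
[cite: Pal2012, Thm. 3.2] [cite: EdixhovenManin1991, §1] [cite: SilvermanATAEC1994, V.5.3] -/
theorem ClassX3M.cycLowerLeadingTermAt_iff_chiBranchLowerOdd
    (hmod : hasEntireLFunction_rat) (hmodD : nonempty_modularParametrizationData)
    (hX : ClassX3M W p) (hp4 : p % 4 = 3) :
    CycLowerLeadingTermAt W p ↔ ChiBranchLowerLeadingTermOddAt W p := by
  refine ⟨chiBranchLowerLeadingTermOddAt_of_cycLower W p hmod hX.classX3.2, fun hLow ↦ ?_⟩
  obtain ⟨V, iV, iVm, C, hV, hC⟩ := hX.exists_mult_pStar_twist_model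
  rw [pStar_eq_neg_of_mod_four_eq_three hp4] at hC
  haveI : NeZero (V.conductorNorm ℤ) := ⟨(V.conductorNorm_pos_holds).ne'⟩
  obtain ⟨Dm⟩ := hmodD V
  obtain ⟨ϖ, -, hϖ⟩ := exists_rat_mul_imaginaryPeriodRat_eq_minusPeriod Dm
  exact cycLowerLeadingTermAt_of_chiBranchLowerOdd W p hmod hp4 hX.classX3.2 V C hC (Or.inr hV)
    Dm.isNewformOf ϖ hϖ hLow

/-! ### §4 END-TO-END on the (M) locus: branch input ⟹ Miller lower half; non-vacuity of the binders -/

/-- **X4(M) ∧ `r_an = 0`, `p ≡ 1 (mod 4)`: `ChiBranchLowerLeadingTermAt W p ⟹ Typed.MissingLowerBoundAt W p`**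
— the Skinner–Urban direction on the `ω^{(p−1)/2}`-branch of the `p`-multiplicative twist `E♭` at
`T = 0` gives the LOWER half of `BSD(E,p)`: branch ⟹ cyclotomic (§3, Birch + Pal `hPal`) ⟹
every-element form ⟹ Miller (n1011-p18's consumer over the exact Delbourgo 1998 Prop. 4 (M),
`hDelX`; GZK, modularity). NO image, Tamagawa, Manin or certificate hypothesis; N10 stays CONSTRUCTION.
[cite: Delbourgo1998, Prop. 4 (p. 144) and §2.2 Lemma (ii) (p. 139)] [cite: Pal2012, Thm. 3.2] -/
theorem ClassX4M.missingLowerBoundAt_rankZero_of_chiBranchLower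
    (hDelX : Delbourgo1998.prop4_rankZero_constantCoeff_eq_unit_mul_of_potMult)
    (hPal : Pal2012.thm32_sqrt_mul_realPeriodRat_twist_eq_of_prime_one_mod_four)
    (hGZK : rank_eq_analyticRank_of_analyticRank_le_one) (hmod : hasEntireLFunction_rat)
    (hmodD : nonempty_modularParametrizationData)
    (hX : ClassX4M W p) (hp4 : p % 4 = 1) (hr : W.analyticRank = 0)
    (hLow : ChiBranchLowerLeadingTermAt W p) : MissingLowerBoundAt W p :=
  hX.missingLowerBoundAt_rankZero_of_cycLeadingTermDvd hDelX hGZK hmod hr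
    (cycLeadingTermDvdAt_of_cycLowerLeadingTermAt W p
      ((ClassX4M.cycLowerLeadingTermAt_iff_chiBranchLower hPal hmod hmodD hX hp4).mpr hLow))

/-- **X4(M) ∧ `r_an = 0`, `p ≡ 3 (mod 4)` (`p = 3` included):
`ChiBranchLowerLeadingTermOddAt W p ⟹ Typed.MissingLowerBoundAt W p`** (Pal for `d < 0` proved).
[cite: Delbourgo1998, Prop. 4 (p. 144) and §2.2 Lemma (ii) (p. 139)] [cite: Pal2012, Thm. 3.2] -/
theorem ClassX4M.missingLowerBoundAt_rankZero_of_chiBranchLowerOdd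
    (hDelX : Delbourgo1998.prop4_rankZero_constantCoeff_eq_unit_mul_of_potMult)
    (hGZK : rank_eq_analyticRank_of_analyticRank_le_one) (hmod : hasEntireLFunction_rat)
    (hmodD : nonempty_modularParametrizationData)
    (hX : ClassX4M W p) (hp4 : p % 4 = 3) (hr : W.analyticRank = 0)
    (hLow : ChiBranchLowerLeadingTermOddAt W p) : MissingLowerBoundAt W p :=
  hX.missingLowerBoundAt_rankZero_of_cycLeadingTermDvd hDelX hGZK hmod hr
    (cycLeadingTermDvdAt_of_cycLowerLeadingTermAt W p
      ((ClassX4M.cycLowerLeadingTermAt_iff_chiBranchLowerOdd hmod hmodD hX hp4).mpr hLow))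

/-- **X3♯(M) ∧ `r_an = 0`, `p ≡ 1 (mod 4)`: `ChiBranchLowerLeadingTermAt W p ⟹ Typed.MissingLowerBoundAt W p`.**
[cite: Delbourgo1998, Prop. 4 (p. 144) and §2.2 Lemma (ii) (p. 139)] [cite: Pal2012, Thm. 3.2] -/
theorem ClassX3M.missingLowerBoundAt_rankZero_of_chiBranchLower
    (hDelX : Delbourgo1998.prop4_rankZero_constantCoeff_eq_unit_mul_of_potMult)
    (hPal : Pal2012.thm32_sqrt_mul_realPeriodRat_twist_eq_of_prime_one_mod_four)
    (hGZK : rank_eq_analyticRank_of_analyticRank_le_one) (hmod : hasEntireLFunction_rat)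
    (hmodD : nonempty_modularParametrizationData)
    (hX : ClassX3M W p) (hp4 : p % 4 = 1) (hr : W.analyticRank = 0)
    (hLow : ChiBranchLowerLeadingTermAt W p) : MissingLowerBoundAt W p :=
  hX.missingLowerBoundAt_rankZero_of_cycLeadingTermDvd hDelX hGZK hmod hr
    (cycLeadingTermDvdAt_of_cycLowerLeadingTermAt W p
      ((ClassX3M.cycLowerLeadingTermAt_iff_chiBranchLower hPal hmod hmodD hX hp4).mpr hLow))

/-- **X3♯(M) ∧ `r_an = 0`, `p ≡ 3 (mod 4)`: `ChiBranchLowerLeadingTermOddAt W p ⟹ Typed.MissingLowerBoundAt W p`.**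
[cite: Delbourgo1998, Prop. 4 (p. 144) and §2.2 Lemma (ii) (p. 139)] [cite: Pal2012, Thm. 3.2] -/
theorem ClassX3M.missingLowerBoundAt_rankZero_of_chiBranchLowerOdd
    (hDelX : Delbourgo1998.prop4_rankZero_constantCoeff_eq_unit_mul_of_potMult)
    (hGZK : rank_eq_analyticRank_of_analyticRank_le_one) (hmod : hasEntireLFunction_rat)
    (hmodD : nonempty_modularParametrizationData)
    (hX : ClassX3M W p) (hp4 : p % 4 = 3) (hr : W.analyticRank = 0)
    (hLow : ChiBranchLowerLeadingTermOddAt W p) : MissingLowerBoundAt W p :=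
  hX.missingLowerBoundAt_rankZero_of_cycLeadingTermDvd hDelX hGZK hmod hr
    (cycLeadingTermDvdAt_of_cycLowerLeadingTermAt W p
      ((ClassX3M.cycLowerLeadingTermAt_iff_chiBranchLowerOdd hmod hmodD hX hp4).mpr hLow))

omit [W.IsGloballyMinimal] in
/-- **NON-VACUITY of the typed branch inputs on X4(M), `p ≡ 1 (mod 4)`**: the binder set of
`ChiBranchLowerLeadingTermAt W p` is INHABITED on every X4(M) pair — a globally minimal twist model
`V` multiplicative at `p` with `C • V^{(p)} = W` (additive-p1), its newform `f` and period ratio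
`ϖ·Ω_V = Ω⁺_f` (parametrisation datum `hmodD`, Edixhoven), the cyclotomic `ℤ_p`-extension with a
topological generator matching the cyclotomic variable, and a dual datum of `Sel_{p^∞}(W/ℚ_∞)` all
exist. So the ∀-conjecture is not vacuously true. [cite: EdixhovenManin1991, §1] [cite: SilvermanATAEC1994, V.5.3] -/
theorem ClassX4M.exists_semistableTwistDatum (hmodD : nonempty_modularParametrizationData)
    (hX : ClassX4M W p) (hp4 : p % 4 = 1) :
    ∃ (V : WeierstrassCurve ℚ) (_ : V.IsElliptic) (_ : V.IsGloballyMinimal)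
      (κ : ZpExtension ℚ p) (γ : Field.absoluteGaloisGroup ℚ) (N : ℕ) (_ : NeZero N)
      (f : CuspForm (Gamma0 N) 2) (_ : W.SelmerDualData κ γ) (ϖ : ℚ),
      (∃ C : VariableChange ℚ, C • V.quadraticTwist (p : ℚ) = W) ∧ (GoodOrd V p ∨ Mult V p) ∧
        κ.IsCyclotomic ∧ κ.IsTopGenerator γ ∧ IsCyclotomicVariable p γ ∧ IsNewformOf V f ∧
        (ϖ : ℝ) * V.realPeriodRat = plusPeriod f := by
  obtain ⟨V, iV, iVm, C, hV, hC⟩ := hX.exists_mult_pStar_twist_model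
  rw [pStar_eq_self_of_mod_four_eq_one hp4] at hC
  haveI : NeZero (V.conductorNorm ℤ) := ⟨(V.conductorNorm_pos_holds).ne'⟩
  obtain ⟨Dm⟩ := hmodD V
  obtain ⟨ϖ, -, hϖ, -⟩ := Dm.exists_rat_mul_realPeriodRat_eq_plusPeriod
  obtain ⟨κ, hκ, γ, hγ, hγ'⟩ := exists_isCyclotomic_isTopGenerator_isCyclotomicVariable_holds p
  obtain ⟨D⟩ := W.nonempty_selmerDualData_holds κ γ hγ
  exact ⟨V, iV, iVm, κ, γ, _, inferInstance, Dm.f, D, ϖ, ⟨C, hC⟩, Or.inr hV, hκ, hγ, hγ', Dm.isNewformOf, hϖ⟩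

omit [W.IsGloballyMinimal] in
/-- **NON-VACUITY of the typed branch inputs on X4(M), `p ≡ 3 (mod 4)`** (twist by `−p`, minus
period ratio `ϖ⁻·|Ω⁻(V)| = Ω⁻_f`). [cite: EdixhovenManin1991, §1] [cite: SilvermanATAEC1994, V.5.3] -/
theorem ClassX4M.exists_semistableTwistDatum_odd (hmodD : nonempty_modularParametrizationData)
    (hX : ClassX4M W p) (hp4 : p % 4 = 3) :
    ∃ (V : WeierstrassCurve ℚ) (_ : V.IsElliptic) (_ : V.IsGloballyMinimal)
      (κ : ZpExtension ℚ p) (γ : Field.absoluteGaloisGroup ℚ) (N : ℕ) (_ : NeZero N)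
      (f : CuspForm (Gamma0 N) 2) (_ : W.SelmerDualData κ γ) (ϖ : ℚ),
      (∃ C : VariableChange ℚ, C • V.quadraticTwist (-(p : ℚ)) = W) ∧ (GoodOrd V p ∨ Mult V p) ∧
        κ.IsCyclotomic ∧ κ.IsTopGenerator γ ∧ IsCyclotomicVariable p γ ∧ IsNewformOf V f ∧
        (ϖ : ℝ) * V.imaginaryPeriodRat = minusPeriod f := by
  obtain ⟨V, iV, iVm, C, hV, hC⟩ := hX.exists_mult_pStar_twist_model
  rw [pStar_eq_neg_of_mod_four_eq_three hp4] at hC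
  haveI : NeZero (V.conductorNorm ℤ) := ⟨(V.conductorNorm_pos_holds).ne'⟩
  obtain ⟨Dm⟩ := hmodD V
  obtain ⟨ϖ, -, hϖ⟩ := exists_rat_mul_imaginaryPeriodRat_eq_minusPeriod Dm
  obtain ⟨κ, hκ, γ, hγ, hγ'⟩ := exists_isCyclotomic_isTopGenerator_isCyclotomicVariable_holds p
  obtain ⟨D⟩ := W.nonempty_selmerDualData_holds κ γ hγ
  exact ⟨V, iV, iVm, κ, γ, _, inferInstance, Dm.f, D, ϖ, ⟨C, hC⟩, Or.inr hV, hκ, hγ, hγ', Dm.isNewformOf, hϖ⟩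

end Summit.BirchSwinnertonDyer.Rank1Residual.AdditivePotMult

end
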